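import Literature.Combinatorics.Optimization.ShellLawCentredMomentMainBound
import Literature.Combinatorics.Optimization.ShellLawWeightedPointwiseMixture
import Literature.Combinatorics.Optimization.ShellLawRelativeLevelSmoothness
import HarnessLib

/-!
# The per-pair `x`-smoothness numbers of the centred-second-moment main term, discharged by the type margins and the
# window (level `1`, ground set `univ`)

Continuation of `ShellLawCentredMomentMainBound.lean` (`abs_main_one_le` / `abs_levelStep_centredSecond_le`: the `k = 1` term
of the centred second moment is bounded from PER-PAIR `x`-smoothness numbers of the three weighted sections `P₁ = E[1_{X=y}(n_A−m)²]`,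
`P₂ = E[1_{X=y}n_A(n_A−1)]`, `P₃ = E[1_{X=y}n_A]` of the two-edge-deleted ground sets) and `ShellLawWeightedPointwiseMixture.lean`
(§7 `abs_nab2_iter_weightedSection_one_le`: the level-`1` moderate-deviation bound for a weighted section with `0 ≤ w ≤ W̄`).
Here the per-pair hypotheses are DISCHARGED for the ground set `univ` of a fixed-point-free involution `π` on `Fin n`
(`n = 2N₀`, block `H` of type `(a,b,d)`) at base level `c₀ = 1`, cut `2r+7` (so the deleted ground sets carry the cut
`2r+5 = 1 + 2(r+2)`): every two-edge-deleted ground set `S′` (`|S′| + 4 = n`) has type within `2` of `(a,b,d)` with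
`a′+b′+d′ = N₀ − 2` (`deleted_types`), its reference point `x − u` (`u ∈ {0,1}`) stays within `Λ = ε + 15` of its own centre
(`window_transfer`), and the three weights obey `(α−m)² ≤ (r+2+|m|)²`, `α(α−1) ≤ (r+2)²`, `α ≤ r+2` on `α ≤ r+2`.

* §1 `sq_sub_le_of_le`, `natCast_mul_sub_one_le_sq` (weight bounds);
* §2 **`smooth₃_of_deleted`** — for ONE `π`-stable `S′ ⊆ univ` with `|S′| + 4 = n` and a reference `y₀` with `y₀ + u = x`, `u ≤ 1`:
  the three inequalities `|P_i(S′,2r+5,x) − 2P_i(S′,2r+5,x−1) + P_i(S′,2r+5,x−2)| ≤ E·P_i(S′,2r+5,y₀) + W̄_i·Far` for any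
  `E ≥ E₁(N₀−2, L, Λ, β)` and `Far ≥ 4e^{−(L−2)²/(4(N₀−2))}`;
* §3 **`mainSmoothness_of_type`** — the hypotheses `hXA` (reference `x`, the `AD` pairs) and `hXB` (reference `x − 1`, the `BB`
  pairs) of `abs_main_one_le` / `abs_levelStep_centredSecond_le` at `c₀ = 1`, `t₀ = 2r+1`, from the type margins
  `b, d ≥ βN₀ + 3`, the balanced cut `βN₀ ≤ r+2`, `8(r+2) ≤ (4+β)(N₀−2)`, the window `|x − (2r+7)(2a+b)/(2N₀)| ≤ ε`, `1 ≤ x`,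
  and the numeric side conditions of §7 at `N′ = N₀ − 2`.

All PROVED, 0 sorry, no definitions, no named facts; constants crude and asymptotic only (those of
`ShellLawBulkSmoothness`). Cell pnp-psdrank (prover g27, MEMO-30 §2/§3): with (V) (lit: `centredSq_section_ge_of_brackets`)
and brick 133 for `B^m_3` this closes the `k = 1` term of input (ii) of the γ-direction criterion up to numerics; nothing here
is about psd rank or P vs NP.

## References
* [RollinRoss2010] A. Röllin, N. Ross, *Local limit theorems via Landau–Kolmogorov inequalities*, Bernoulli 21 (2015)
  851–880, §3 Lemma 3.3, §4.1 Thm 4.2.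
* [Rothvoss2017] T. Rothvoß, *The matching polytope has exponential extension complexity*, J. ACM 64 (2017), §2
  (PDF pp. 5–6).
* [Durrett2019] R. Durrett, *Probability: Theory and Examples*, 5th ed. (2019), §2.7 (Chernoff).
-/

noncomputable section

open Finset

namespace Literature.Combinatorics.Optimization

namespace ShellStep

variable {n : ℕ} {π : Fin n → Fin n}

/-! ### §1 Weight bounds -/

/-- `(α − m)² ≤ (s + |m|)²` for `α ≤ s`. [cite: Rothvoss2017, §2 (PDF p. 6)] -/
theorem sq_sub_le_of_le {α s : ℕ} (h : α ≤ s) (m : ℝ) : ((α : ℝ) - m) ^ 2 ≤ ((s : ℝ) + |m|) ^ 2 := by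
  have hα : (α : ℝ) ≤ s := by exact_mod_cast h
  have h0 : (0 : ℝ) ≤ α := Nat.cast_nonneg _
  have h1 : |(α : ℝ) - m| ≤ (s : ℝ) + |m| := by
    refine (abs_sub _ _).trans ?_
    rw [abs_of_nonneg h0]; linarith
  have h2 : 0 ≤ (s : ℝ) + |m| := by positivity
  calc ((α : ℝ) - m) ^ 2 = |(α : ℝ) - m| ^ 2 := (sq_abs _).symm
    _ ≤ ((s : ℝ) + |m|) ^ 2 := pow_le_pow_left₀ (abs_nonneg _) h1 2

/-- `α(α−1) ≤ s²` for `α ≤ s`. [cite: Rothvoss2017, §2 (PDF p. 6)] -/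
theorem natCast_mul_sub_one_le_sq {α s : ℕ} (h : α ≤ s) : (α : ℝ) * ((α : ℝ) - 1) ≤ (s : ℝ) ^ 2 := by
  have hα : (α : ℝ) ≤ s := by exact_mod_cast h
  have h0 : (0 : ℝ) ≤ α := Nat.cast_nonneg _
  nlinarith

/-! ### §2 One deleted ground set: the three weighted sections at level `1` -/

section Deleted

variable (hπ : ∀ v, π (π v) = v) (hπ' : ∀ v, π v ≠ v)
include hπ hπ'

omit hπ hπ' in
/-- `(∇²)^1` of a profile, spelled out. [cite: RollinRoss2010, §3 (Lemma 3.1)] -/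
theorem nab2_iter_one_apply (P : Profile) (c : ℕ) (x : ℤ) :
    nab2^[1] P c x = P c x - 2 * P c (x - 1) + P c (x - 2) := by
  rw [Function.iterate_one]; rfl

omit hπ hπ' in
/-- Monotonicity of a two-term bound. [cite: RollinRoss2010, §3 (Lemma 3.3)] -/
theorem le_of_le_mul_add_mul {D P E₁ E W F₁ F : ℝ} (h : D ≤ E₁ * P + W * F₁) (hP : 0 ≤ P) (hW : 0 ≤ W)
    (hE : E₁ ≤ E) (hF : F₁ ≤ F) : D ≤ E * P + W * F := by
  nlinarith [mul_le_mul_of_nonneg_right hE hP, mul_le_mul_of_nonneg_left hF hW]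

/-- **The three weighted sections of ONE two-edge-deleted ground set at level `1`.** `π` a fixed-point-free involution on
`Fin n`, `n = 2N₀`, `H` of type `(a,b,d)` (`a+b+d = N₀`), `b, d ≥ βN₀ + 3` (`0 < β ≤ 1`), `βN₀ ≤ r+2`, `8(r+2) ≤ (4+β)(N₀−2)`,
`r + 4 ≤ N₀`, `16 ≤ N₀`; a `π`-stable `S′` with `|S′| + 4 = n`; naturals `y₀ + u = x` with `u ≤ 1` and the window
`|x − (2r+7)(2a+b)/(2N₀)| ≤ ε`; `L ≥ 2` with the side conditions of `abs_nab2_iter_weightedSection_one_le` at `N′ = N₀ − 2`, `Λ = ε + 15`;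
a centring `m`; sections `P₁, P₂, P₃` (level `1`); bounds `E ≥ E₁(N₀−2)`, `Far ≥ 4e^{−(L−2)²/(4(N₀−2))}`. Then for `i = 1,2,3`
`|P_i(S′,2r+5,x) − 2P_i(S′,2r+5,x−1) + P_i(S′,2r+5,x−2)| ≤ E·P_i(S′,2r+5,y₀) + W̄_i·Far`, `W̄ = (r+2+|m|)², (r+2)², r+2`.
[cite: RollinRoss2010, §3 (Lemma 3.3), §4.1 Thm 4.2] [cite: Rothvoss2017, §2 (PDF p. 6)] [cite: Durrett2019, §2.7] -/
theorem smooth₃_of_deleted (H : Finset (Fin n)) {a b d N₀ : ℕ} (ha : (reps π (vAA π univ H)).card = a)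
    (hb : (reps π (vBH π univ H ∪ vBN π univ H)).card = b) (hd : (reps π (vDD π univ H)).card = d)
    (hN : a + b + d = N₀)
    {β : ℝ} (hβ : 0 < β) (hβ1 : β ≤ 1) (hbβ : β * N₀ + 3 ≤ b) (hdβ : β * N₀ + 3 ≤ d)
    {r : ℕ} (hs : β * N₀ ≤ (r : ℝ) + 2) (hs' : 8 * ((r : ℝ) + 2) ≤ (4 + β) * ((N₀ : ℝ) - 2)) (hrN : r + 4 ≤ N₀)
    (hN16 : 16 ≤ N₀)
    {S' : Finset (Fin n)} (hS' : ∀ v ∈ S', π v ∈ S') (hcard : S'.card + 4 = n)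
    {x y₀ u : ℕ} (hu : u ≤ 1) (hyu : y₀ + u = x) {ε : ℝ}
    (hxε : |(x : ℝ) - (2 * ((r : ℝ) + 3) + 1) * (2 * a + b) / (2 * N₀)| ≤ ε)
    {L : ℝ} (h2L : 2 ≤ L) (hLN : L - 2 ≤ 2 * ((N₀ : ℝ) - 2))
    (hL1 : L + 1 + (ε + 15) ≤ β * ((r : ℝ) + 2)) (hL2 : L + 1 + (ε + 15) + 3 ≤ β * ((N₀ : ℝ) - 2) / 8)
    (hwin : 2 * (L + 1 + 1) ≤ (β ^ 2 / 8) ^ 2 * (β * ((N₀ : ℝ) - 2))) (hN4 : 4 ≤ β * ((N₀ : ℝ) - 2))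
    (hkV : (1 : ℝ) * (1 + 8 * (L + 1 + 1) / ((β ^ 2 / 8) ^ 4 * (β * ((N₀ : ℝ) - 2)))) ≤
      (β ^ 2 / 8) ^ 4 * (β * ((N₀ : ℝ) - 2)))
    (m : ℝ) (P₁ P₂ P₃ : Finset (Fin n) → ℕ → ℤ → ℝ)
    (hP₁ : ∀ T t' y, P₁ T t' y = (∑ U ∈ ((shellIn π T t' 1).filter fun U => ((U ∩ H).card : ℤ) = y),
        (((((reps π (vAA π T H)).filter fun v => v ∈ U ∧ π v ∈ U).card : ℕ) : ℝ) - m) ^ 2) /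
        ((shellIn π T t' 1).card : ℝ))
    (hP₂ : ∀ T t' y, P₂ T t' y = (∑ U ∈ ((shellIn π T t' 1).filter fun U => ((U ∩ H).card : ℤ) = y),
        (((((reps π (vAA π T H)).filter fun v => v ∈ U ∧ π v ∈ U).card : ℕ) : ℝ) *
          (((((reps π (vAA π T H)).filter fun v => v ∈ U ∧ π v ∈ U).card : ℕ) : ℝ) - 1))) /
        ((shellIn π T t' 1).card : ℝ))
    (hP₃ : ∀ T t' y, P₃ T t' y = (∑ U ∈ ((shellIn π T t' 1).filter fun U => ((U ∩ H).card : ℤ) = y),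
        ((((reps π (vAA π T H)).filter fun v => v ∈ U ∧ π v ∈ U).card : ℕ) : ℝ)) /
        ((shellIn π T t' 1).card : ℝ))
    {E Far : ℝ}
    (hE : (((1 + 8 * (L + 1 + 1) / ((β ^ 2 / 8) ^ 4 * (β * ((N₀ : ℝ) - 2)))) *
            (8 * (L + 1 + 1) / ((β ^ 2 / 8) ^ 4 * (β * ((N₀ : ℝ) - 2))) +
              2 * Real.sqrt 192 * Real.sqrt (2 * (2 * (1 : ℝ) + 1) *
                (1 + 8 * (L + 1 + 1) / ((β ^ 2 / 8) ^ 4 * (β * ((N₀ : ℝ) - 2)))) /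
                  ((β ^ 2 / 8) ^ 4 * (β * ((N₀ : ℝ) - 2)))))) ^ (2 * 1) *
          (1 + 4 * (Real.sqrt ((N₀ : ℝ) - 2) + 1) / 3 *
            (2 * Real.sqrt 192 * Real.sqrt (2 * (2 * (1 : ℝ) + 1) *
              (1 + 8 * (L + 1 + 1) / ((β ^ 2 / 8) ^ 4 * (β * ((N₀ : ℝ) - 2)))) /
                ((β ^ 2 / 8) ^ 4 * (β * ((N₀ : ℝ) - 2))))))) ≤ E)
    (hFar : (4 : ℝ) ^ 1 * Real.exp (-((L - 2 * 1) ^ 2 / (4 * ((N₀ : ℝ) - 2)))) ≤ Far) :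
    |P₁ S' (2 * r + 1 + 4) x - 2 * P₁ S' (2 * r + 1 + 4) (x - 1) + P₁ S' (2 * r + 1 + 4) (x - 2)| ≤
        E * P₁ S' (2 * r + 1 + 4) y₀ + (((r : ℝ) + 2) + |m|) ^ 2 * Far ∧
      |P₂ S' (2 * r + 1 + 4) x - 2 * P₂ S' (2 * r + 1 + 4) (x - 1) + P₂ S' (2 * r + 1 + 4) (x - 2)| ≤
        E * P₂ S' (2 * r + 1 + 4) y₀ + ((r : ℝ) + 2) ^ 2 * Far ∧
      |P₃ S' (2 * r + 1 + 4) x - 2 * P₃ S' (2 * r + 1 + 4) (x - 1) + P₃ S' (2 * r + 1 + 4) (x - 2)| ≤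
        E * P₃ S' (2 * r + 1 + 4) y₀ + ((r : ℝ) + 2) * Far := by
  classical
  -- types and sizes of `S'`
  have hcard' : S'.card + 4 * 1 = n := by omega
  obtain ⟨ha1, ha2, hb1, hb2, hd1, hd2, hN'⟩ := deleted_types hπ hπ' H ha hb hd hN hS' hcard'
  generalize ha' : (reps π (vAA π S' H)).card = a' at ha1 ha2 hN'
  generalize hb' : (reps π (vBH π S' H ∪ vBN π S' H)).card = b' at hb1 hb2 hN'
  generalize hd' : (reps π (vDD π S' H)).card = d' at hd1 hd2 hN'
  obtain ⟨N', hN'def⟩ : ∃ N' : ℕ, N' + 2 = N₀ := ⟨a' + b' + d', by omega⟩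
  have hN'sum : a' + b' + d' = N' := by omega
  have hN'r : (N' : ℝ) = (N₀ : ℝ) - 2 := by
    have : ((N' + 2 : ℕ) : ℝ) = N₀ := by rw [hN'def]
    push_cast at this; linarith only [this]
  have hN₀r : (16 : ℝ) ≤ N₀ := by exact_mod_cast hN16
  have hN₀pos : (0 : ℝ) < N₀ := by linarith only [hN₀r]
  have hβN : β * (N₀ : ℝ) ≤ N₀ := mul_le_of_le_one_left hN₀pos.le hβ1
  have ha1r : (a : ℝ) ≤ a' + 2 := by exact_mod_cast ha1
  have ha2r : (a' : ℝ) ≤ a := by exact_mod_cast ha2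
  have hb1r : (b : ℝ) ≤ b' + 2 := by exact_mod_cast hb1
  have hb2r : (b' : ℝ) ≤ b := by exact_mod_cast hb2
  have hd1r : (d : ℝ) ≤ d' + 2 := by exact_mod_cast hd1
  have hNr : (a : ℝ) + b + d = N₀ := by exact_mod_cast hN
  -- the hypotheses of §7 on `S'` (with `N ↦ N'`, `s ↦ r+2`, `k ↦ 1`)
  have hbβ' : β * N' + 1 ≤ b' := by rw [hN'r]; linarith only [hbβ, hb1r, hβ.le]
  have hdβ' : β * N' + 1 ≤ d' := by rw [hN'r]; linarith only [hdβ, hd1r, hβ.le]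
  have hs2 : β * N' ≤ ((r + 2 : ℕ) : ℝ) := by push_cast; rw [hN'r]; linarith only [hs, hβ.le]
  have hs2' : 8 * (((r + 2 : ℕ) : ℝ)) ≤ (4 + β) * N' := by push_cast; rw [hN'r]; exact hs'
  have hsN' : r + 2 ≤ N' := by omega
  have hu2 : u ≤ 2 * 1 := by omega
  have hLN' : L - 2 * (1 : ℕ) ≤ 2 * (N' : ℝ) := by rw [hN'r]; push_cast; linarith only [hLN]
  have h2L' : 2 * ((1 : ℕ) : ℝ) ≤ L := by push_cast; linarith only [h2L]
  have hL1' : L + (1 : ℕ) + (ε + 15) ≤ β * ((r + 2 : ℕ) : ℝ) := by push_cast; linarith only [hL1]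
  have hL2' : L + (1 : ℕ) + (ε + 15) + 3 ≤ β * N' / 8 := by rw [hN'r]; push_cast; linarith only [hL2]
  have hwin' : 2 * (L + (1 : ℕ) + 1) ≤ (β ^ 2 / 8) ^ 2 * (β * N') := by rw [hN'r]; push_cast; linarith only [hwin]
  have hN4' : 4 ≤ β * N' := by rw [hN'r]; exact hN4
  have hkV' : ((1 : ℕ) : ℝ) * (1 + 8 * (L + (1 : ℕ) + 1) / ((β ^ 2 / 8) ^ 4 * (β * N'))) ≤
      (β ^ 2 / 8) ^ 4 * (β * N') := by rw [hN'r]; push_cast; exact hkV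
  -- the window transfer: `|y₀ − (r+2)(2a′+b′)/N′| ≤ ε + 15`
  have hy : |(y₀ : ℝ) - ((r + 2 : ℕ) : ℝ) * (2 * a' + b') / N'| ≤ ε + 15 := by
    have hw := window_transfer (P := (2 * a + b : ℝ)) (P' := (2 * a' + b' : ℝ)) (s := (r : ℝ) + 3) (N₀ := N₀)
      (k := 1) (x := x) (w₀ := u) (ε := ε) hN₀pos (by positivity) (by linarith only [ha2r, hb2r])
      (by linarith only [hNr, (Nat.cast_nonneg d : (0 : ℝ) ≤ d)]) (by linarith only [ha1r, hb1r]) (by positivity)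
      (by linarith only [hs', hβN, hβ.le]) zero_le_one (by linarith only [hN₀r]) (Nat.cast_nonneg _)
      (by have : (u : ℝ) ≤ 1 := by exact_mod_cast hu
          linarith only [this]) hxε
    have e1 : (y₀ : ℝ) = x - u := by
      have : ((y₀ + u : ℕ) : ℝ) = x := by rw [hyu]
      push_cast at this; linarith only [this]
    have e2 : ((r + 2 : ℕ) : ℝ) * (2 * a' + b') / N' = ((r : ℝ) + 3 - 1) * (2 * a' + b') / ((N₀ : ℝ) - 2 * 1) := by
      rw [hN'r]; push_cast; ring
    rw [e1, e2]
    have : ε + 14 * 1 + 1 = ε + 15 := by ring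
    rw [this] at hw
    exact hw
  -- the point identities
  have hxz : (((y₀ + u : ℕ) : ℤ)) = (x : ℤ) := by rw [hyu]
  have hcut : 1 + 2 * (r + 2) = 2 * r + 1 + 4 := by ring
  -- nonnegativity of the three reference sections
  have hP₁0 : 0 ≤ P₁ S' (2 * r + 1 + 4) y₀ := by
    rw [hP₁]; exact div_nonneg (sum_nonneg fun _ _ => sq_nonneg _) (Nat.cast_nonneg _)
  have hP₂0 : 0 ≤ P₂ S' (2 * r + 1 + 4) y₀ := by
    rw [hP₂]; exact div_nonneg (sum_nonneg fun _ _ => natCast_mul_sub_one_nonneg _) (Nat.cast_nonneg _)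
  have hP₃0 : 0 ≤ P₃ S' (2 * r + 1 + 4) y₀ := by
    rw [hP₃]; exact div_nonneg (sum_nonneg fun _ _ => Nat.cast_nonneg _) (Nat.cast_nonneg _)
  have hm0 : 0 ≤ ((r : ℝ) + 2) + |m| := by positivity
  -- §7 for the three weights
  have h1 := abs_nab2_iter_weightedSection_one_le hπ hπ' hS' H (a := a') hb' hd' hN'sum hβ hβ1 hbβ' hdβ' hs2 hs2' hsN'
    (fun k : ℕ => ((k : ℝ) - m) ^ 2) (Wb := (((r : ℝ) + 2) + |m|) ^ 2) (fun _ _ => sq_nonneg _)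
    (fun α hα => by have := sq_sub_le_of_le hα m; push_cast at this; exact this) hu2 h2L' hLN' hL1' hL2' hwin' hN4' hkV' hy
  have h2 := abs_nab2_iter_weightedSection_one_le hπ hπ' hS' H (a := a') hb' hd' hN'sum hβ hβ1 hbβ' hdβ' hs2 hs2' hsN'
    (fun k : ℕ => (k : ℝ) * ((k : ℝ) - 1)) (Wb := ((r : ℝ) + 2) ^ 2) (fun k _ => natCast_mul_sub_one_nonneg k)
    (fun α hα => by have := natCast_mul_sub_one_le_sq hα; push_cast at this; exact this)
    hu2 h2L' hLN' hL1' hL2' hwin' hN4' hkV' hy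
  have h3 := abs_nab2_iter_weightedSection_one_le hπ hπ' hS' H (a := a') hb' hd' hN'sum hβ hβ1 hbβ' hdβ' hs2 hs2' hsN'
    (fun k : ℕ => (k : ℝ)) (Wb := (r : ℝ) + 2) (fun k _ => Nat.cast_nonneg k)
    (fun α hα => by exact_mod_cast hα) hu2 h2L' hLN' hL1' hL2' hwin' hN4' hkV' hy
  rw [nab2_iter_one_apply, hxz, hcut] at h1 h2 h3
  simp only [← hP₁] at h1
  simp only [← hP₂] at h2
  simp only [← hP₃] at h3
  rw [hN'r] at h1 h2 h3
  push_cast at h1 h2 h3 hE hFar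
  have hFar0 : (0 : ℝ) ≤ (4 : ℝ) ^ 1 * Real.exp (-((L - 2 * 1) ^ 2 / (4 * ((N₀ : ℝ) - 2)))) := by positivity
  refine ⟨le_of_le_mul_add_mul h1 hP₁0 (by positivity) hE hFar, le_of_le_mul_add_mul h2 hP₂0 (by positivity) hE hFar,
    le_of_le_mul_add_mul h3 hP₃0 (by positivity) hE hFar⟩

/-! ### §3 The per-pair hypotheses of `abs_main_one_le` at level `1` on `univ`, from the type -/

/-- **THE PER-PAIR `x`-SMOOTHNESS NUMBERS, DISCHARGED BY THE TYPE** (ground set `univ`, base level `c₀ = 1`, cut `2r+7`, i.e.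
`t₀ = 2r+1` in `abs_main_one_le`). `π` a fixed-point-free involution on `Fin n`, `H` of type `(a,b,d)` (`a+b+d = N₀`, `16 ≤ N₀`,
`r+4 ≤ N₀`), margins `b, d ≥ βN₀ + 3` (`0 < β ≤ 1`), `βN₀ ≤ r+2`, `8(r+2) ≤ (4+β)(N₀−2)`, a point `1 ≤ x` in the window
`|x − (2r+7)(2a+b)/(2N₀)| ≤ ε`, `L ≥ 2` with the side conditions of `abs_nab2_iter_weightedSection_one_le` at `N′ = N₀−2`,
`Λ = ε+15`, bounds `E ≥ E₁(N₀−2)`, `Far ≥ 4e^{−(L−2)²/(4(N₀−2))}`. Then the hypotheses `hXA` (every `AD` pair, reference `x`) and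
`hXB` (every `BB` pair, reference `x−1`) of `abs_main_one_le` / `abs_levelStep_centredSecond_le` hold with
`F₁ = (r+2+|m|)²·Far`, `F₂ = (r+2)²·Far`, `F₃ = (r+2)·Far`.
[cite: RollinRoss2010, §3 (Lemma 3.3), §4.1 Thm 4.2] [cite: Rothvoss2017, §2 (PDF p. 6)] [cite: Durrett2019, §2.7] -/
theorem mainSmoothness_of_type (H : Finset (Fin n)) {a b d N₀ : ℕ} (ha : (reps π (vAA π univ H)).card = a)
    (hb : (reps π (vBH π univ H ∪ vBN π univ H)).card = b) (hd : (reps π (vDD π univ H)).card = d)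
    (hN : a + b + d = N₀)
    {β : ℝ} (hβ : 0 < β) (hβ1 : β ≤ 1) (hbβ : β * N₀ + 3 ≤ b) (hdβ : β * N₀ + 3 ≤ d)
    {r : ℕ} (hs : β * N₀ ≤ (r : ℝ) + 2) (hs' : 8 * ((r : ℝ) + 2) ≤ (4 + β) * ((N₀ : ℝ) - 2)) (hrN : r + 4 ≤ N₀)
    (hN16 : 16 ≤ N₀) {x : ℕ} (hx1 : 1 ≤ x) {ε : ℝ}
    (hxε : |(x : ℝ) - (2 * ((r : ℝ) + 3) + 1) * (2 * a + b) / (2 * N₀)| ≤ ε)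
    {L : ℝ} (h2L : 2 ≤ L) (hLN : L - 2 ≤ 2 * ((N₀ : ℝ) - 2))
    (hL1 : L + 1 + (ε + 15) ≤ β * ((r : ℝ) + 2)) (hL2 : L + 1 + (ε + 15) + 3 ≤ β * ((N₀ : ℝ) - 2) / 8)
    (hwin : 2 * (L + 1 + 1) ≤ (β ^ 2 / 8) ^ 2 * (β * ((N₀ : ℝ) - 2))) (hN4 : 4 ≤ β * ((N₀ : ℝ) - 2))
    (hkV : (1 : ℝ) * (1 + 8 * (L + 1 + 1) / ((β ^ 2 / 8) ^ 4 * (β * ((N₀ : ℝ) - 2)))) ≤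
      (β ^ 2 / 8) ^ 4 * (β * ((N₀ : ℝ) - 2)))
    (m : ℝ) (P₁ P₂ P₃ : Finset (Fin n) → ℕ → ℤ → ℝ)
    (hP₁ : ∀ T t' y, P₁ T t' y = (∑ U ∈ ((shellIn π T t' 1).filter fun U => ((U ∩ H).card : ℤ) = y),
        (((((reps π (vAA π T H)).filter fun v => v ∈ U ∧ π v ∈ U).card : ℕ) : ℝ) - m) ^ 2) /
        ((shellIn π T t' 1).card : ℝ))
    (hP₂ : ∀ T t' y, P₂ T t' y = (∑ U ∈ ((shellIn π T t' 1).filter fun U => ((U ∩ H).card : ℤ) = y),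
        (((((reps π (vAA π T H)).filter fun v => v ∈ U ∧ π v ∈ U).card : ℕ) : ℝ) *
          (((((reps π (vAA π T H)).filter fun v => v ∈ U ∧ π v ∈ U).card : ℕ) : ℝ) - 1))) /
        ((shellIn π T t' 1).card : ℝ))
    (hP₃ : ∀ T t' y, P₃ T t' y = (∑ U ∈ ((shellIn π T t' 1).filter fun U => ((U ∩ H).card : ℤ) = y),
        ((((reps π (vAA π T H)).filter fun v => v ∈ U ∧ π v ∈ U).card : ℕ) : ℝ)) /
        ((shellIn π T t' 1).card : ℝ))
    {E Far : ℝ}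
    (hE : (((1 + 8 * (L + 1 + 1) / ((β ^ 2 / 8) ^ 4 * (β * ((N₀ : ℝ) - 2)))) *
            (8 * (L + 1 + 1) / ((β ^ 2 / 8) ^ 4 * (β * ((N₀ : ℝ) - 2))) +
              2 * Real.sqrt 192 * Real.sqrt (2 * (2 * (1 : ℝ) + 1) *
                (1 + 8 * (L + 1 + 1) / ((β ^ 2 / 8) ^ 4 * (β * ((N₀ : ℝ) - 2)))) /
                  ((β ^ 2 / 8) ^ 4 * (β * ((N₀ : ℝ) - 2)))))) ^ (2 * 1) *
          (1 + 4 * (Real.sqrt ((N₀ : ℝ) - 2) + 1) / 3 *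
            (2 * Real.sqrt 192 * Real.sqrt (2 * (2 * (1 : ℝ) + 1) *
              (1 + 8 * (L + 1 + 1) / ((β ^ 2 / 8) ^ 4 * (β * ((N₀ : ℝ) - 2)))) /
                ((β ^ 2 / 8) ^ 4 * (β * ((N₀ : ℝ) - 2))))))) ≤ E)
    (hFar : (4 : ℝ) ^ 1 * Real.exp (-((L - 2 * 1) ^ 2 / (4 * ((N₀ : ℝ) - 2)))) ≤ Far) :
    (∀ p ∈ vAA π univ H, ∀ q ∈ vDD π univ H,
      |P₁ (del2 π univ p q) (2 * r + 1 + 4) x - 2 * P₁ (del2 π univ p q) (2 * r + 1 + 4) (x - 1) +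
            P₁ (del2 π univ p q) (2 * r + 1 + 4) (x - 2)| ≤
          E * P₁ (del2 π univ p q) (2 * r + 1 + 4) x + (((r : ℝ) + 2) + |m|) ^ 2 * Far ∧
        |P₂ (del2 π univ p q) (2 * r + 1 + 4) x - 2 * P₂ (del2 π univ p q) (2 * r + 1 + 4) (x - 1) +
            P₂ (del2 π univ p q) (2 * r + 1 + 4) (x - 2)| ≤
          E * P₂ (del2 π univ p q) (2 * r + 1 + 4) x + ((r : ℝ) + 2) ^ 2 * Far ∧
        |P₃ (del2 π univ p q) (2 * r + 1 + 4) x - 2 * P₃ (del2 π univ p q) (2 * r + 1 + 4) (x - 1) +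
            P₃ (del2 π univ p q) (2 * r + 1 + 4) (x - 2)| ≤
          E * P₃ (del2 π univ p q) (2 * r + 1 + 4) x + ((r : ℝ) + 2) * Far) ∧
    (∀ p ∈ vBH π univ H, ∀ q ∈ (vBN π univ H).erase (π p),
      |P₁ (del2 π univ p q) (2 * r + 1 + 4) x - 2 * P₁ (del2 π univ p q) (2 * r + 1 + 4) (x - 1) +
            P₁ (del2 π univ p q) (2 * r + 1 + 4) (x - 2)| ≤
          E * P₁ (del2 π univ p q) (2 * r + 1 + 4) ((x : ℤ) - 1) + (((r : ℝ) + 2) + |m|) ^ 2 * Far ∧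
        |P₂ (del2 π univ p q) (2 * r + 1 + 4) x - 2 * P₂ (del2 π univ p q) (2 * r + 1 + 4) (x - 1) +
            P₂ (del2 π univ p q) (2 * r + 1 + 4) (x - 2)| ≤
          E * P₂ (del2 π univ p q) (2 * r + 1 + 4) ((x : ℤ) - 1) + ((r : ℝ) + 2) ^ 2 * Far ∧
        |P₃ (del2 π univ p q) (2 * r + 1 + 4) x - 2 * P₃ (del2 π univ p q) (2 * r + 1 + 4) (x - 1) +
            P₃ (del2 π univ p q) (2 * r + 1 + 4) (x - 2)| ≤
          E * P₃ (del2 π univ p q) (2 * r + 1 + 4) ((x : ℤ) - 1) + ((r : ℝ) + 2) * Far) := by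
  classical
  have hst : ∀ v ∈ (univ : Finset (Fin n)), π v ∈ univ := fun v _ => mem_univ _
  have hcard : ∀ p q : Fin n, q ≠ p → q ≠ π p → (del2 π univ p q).card + 4 = n := by
    intro p q hqp hqπ
    have h := card_del2_add_four hπ hπ' hst (mem_univ p) (mem_univ q) hqp hqπ
    rwa [card_univ, Fintype.card_fin] at h
  constructor
  · intro p hp q hq
    obtain ⟨-, hpH, hπpH⟩ := mem_vAA.1 hp
    obtain ⟨-, hqH, -⟩ := mem_vDD.1 hq
    have hqp : q ≠ p := fun e => hqH (by rw [e]; exact hpH)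
    have hqπ : q ≠ π p := fun e => hqH (by rw [e]; exact hπpH)
    exact smooth₃_of_deleted hπ hπ' H ha hb hd hN hβ hβ1 hbβ hdβ hs hs' hrN hN16 (del2_stable hπ hst p q) (hcard p q hqp hqπ)
      (u := 0) (Nat.zero_le _) (Nat.add_zero x) hxε h2L hLN hL1 hL2 hwin hN4 hkV m P₁ P₂ P₃ hP₁ hP₂ hP₃ hE hFar
  · intro p hp q hq
    obtain ⟨-, hpH, -⟩ := mem_vBH.1 hp
    obtain ⟨hqπp, hq'⟩ := mem_erase.1 hq
    obtain ⟨-, hqH, -⟩ := mem_vBN.1 hq'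
    have hqp : q ≠ p := fun e => hqH (by rw [e]; exact hpH)
    have h := smooth₃_of_deleted hπ hπ' H ha hb hd hN hβ hβ1 hbβ hdβ hs hs' hrN hN16 (del2_stable hπ hst p q)
      (hcard p q hqp hqπp) (y₀ := x - 1) (u := 1) le_rfl (by omega) hxε h2L hLN hL1 hL2 hwin hN4 hkV m P₁ P₂ P₃ hP₁ hP₂ hP₃
      hE hFar
    have e : (((x - 1 : ℕ)) : ℤ) = (x : ℤ) - 1 := by omega
    rw [e] at h
    exact h

end Deleted

end ShellStep

end Literature.Combinatorics.Optimization

end
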